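import Literature.Analysis.FluidPDE.SverakLandauObata
import HarnessLib

/-!
# Šverák's classification of `(−1)`-homogeneous steady Navier–Stokes flows — proof of Theorem 1

Analysis/FluidPDE file discharging the named fact
`Literature.Analysis.FluidPDE.Sverak2011_landauClassification` (`SverakLandauClassification.lean`):
**V. Šverák, *On Landau's solutions of the Navier–Stokes equations*, J. Math. Sci. 179 (2011)
208–228 = arXiv:math/0604550, Theorem 1** — a smooth solution `u` of the steady Navier–Stokes
equations in `ℝ³ ∖ {0}` with `λu(λx) = u(x)` (`λ > 0`) is either trivial or a Landau solution.

The proof is the series `SverakLandau*` (all in the `ℝ³ ∖ {0}` rendering, homogeneous functions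
in place of functions on `S²`):

1. `SverakLandauBernoulliAlgebra/Calculus/K`, `SverakLandauTransfer`, `SverakLandauRadialVorticity`
   — **Lemma 1** (`⟪x, curl u⟫ ≡ 0`) and the Bernoulli relation, via the identity
   `ΔK − u·∇K = ⟪x, curl u⟫²` for `K = |x|²(½|u|² + p) − ½⟪x,u⟫² − ⟪x,u⟫` and E. Hopf's strong
   maximum principle (in print: a Fredholm-alternative argument);
2. `SverakLandauPoincare`, `SverakLandauTangential` — "`v = ∇φ`" (Poincaré lemma on `ℝ³ ∖ {0}`);
3. `SverakLandauConformalCalc`, `SverakLandauConformal` — "`c = 0`", "`w = c₁e^φ`", (E4):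
   `2 + ⟪x, u⟫ = 2e^Φ`;
4. `SverakLandauObataAlgebra/Calculus/Setup`, `SverakLandauObata` — the solutions of (E4):
   `e^{−Φ/2}` is affine on spheres (in print: conformal geometry of `S²`; here: an Obata-type
   identity);
5. `SverakLandauEndgame` — the Landau formulae (4.7).

## References

* V. Šverák, *On Landau's solutions of the Navier–Stokes equations*, J. Math. Sci. 179 (2011)
  208–228, arXiv:math/0604550, §1 Theorem 1, §4. [`Sverak2011`]
-/

noncomputable section

open scoped InnerProductSpace RealInnerProductSpace Laplacian

namespace Literature.Analysis.FluidPDE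

/-- **Šverák 2011, Theorem 1** (classification of scale-invariant steady Navier–Stokes flows in
`ℝ³ ∖ {0}`): the named fact `Sverak2011_landauClassification` holds — every smooth solution of
`−Δu + (u·∇)u + ∇p = 0`, `div u = 0` in `ℝ³ ∖ {0}` with `t u(t x) = u(x)` (`t > 0`) vanishes on
`ℝ³ ∖ {0}` or equals a Landau solution `landauAxisField a c` (`‖a‖ = 1`, `c > 1`) there.
[cite: Sverak2011, §1 Theorem 1] -/
theorem Sverak2011_landauClassification_holds : Sverak2011_landauClassification := by
  intro u p hu hp hns hdiv hhom
  obtain ⟨Φ, hgrad, hF, α, β, hαβ, hα, hΨ⟩ :=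
    Sverak2011.exists_affine_conformalFactor hu hp hns hdiv hhom
  exact Sverak2011.landauAxisField_of_affine hgrad hF hαβ hα hΨ

end Literature.Analysis.FluidPDE
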